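import Summits.HodgeConjecture.HodgeConjecture.Theorems.NikulinTwinTransportTwinSimilitudeAlgebraicHKSectorTheorem
import Summits.HodgeConjecture.HodgeConjecture.Theorems.NikulinTwinTransportTwinSimilitudeAlgebraicStubTopPushProportional
import Summits.HodgeConjecture.HodgeConjecture.Theorems.NikulinTwinTransportTwinSimilitudeAlgebraicStubCorrTranspose
import Summits.HodgeConjecture.HodgeConjecture.Theorems.NikulinTwinTransportTwinSimilitudeAlgebraicStubInverseAnchorAlgebraic
import Summits.HodgeConjecture.HodgeConjecture.Theorems.NikulinTwinTransportTwinSimilitudeAlgebraicStubAnchorForward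
import HarnessLib

/-!
# Route NikulinTwinTransport · crux X = `TwinSimilitudeAlgebraic` (stmt-HodgeConjecture-13674) —
# THE TARGET THEOREM of line `hyperkaehler-nikulin-anchors` (reshape r6, lead c2)

The SECTOR THEOREM (`twinSimilitudeAlgebraic_onHKSector`, file `…HKSectorTheorem`) proves X for every
pair `(S, S′)` of projective K3 surfaces whose SOURCE `S′` lies in the HK-Nikulin sector
(`InHKNikulinSector`: `T_ℚ ↪ (U³ ⊕ E₈(−2) ⊕ ⟨−2⟩)_ℚ` isometrically).  This file adds the TRANSPOSE form —
X for every pair whose TARGET `S` lies in the sector — now that the four transpose stubs of reshape r6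
are theorems of the tree (`stub_topPushProportional` p119716, `stub_corrTranspose` p119770,
`stub_inverseAnchorAlgebraic`, `stub_anchorForward`):

* `simAlg_at_of_outAnchor_target` — X at one pair from an algebraic OUT-anchor `Ψ : H²(S) ⥲ H²(Σ)` at
  the TARGET: `½ · (Ψ ∘ ψ) : H²(S′) → H²(Σ)` is a rational Hodge ISOMETRY (`Ψ` is rational,
  type-preserving, doubling — `stub_anchorForward`; `4 = 2²`), hence algebraic by Buskin at `(Σ, S′)`;
  `Ψ⁻¹` is algebraic (`stub_inverseAnchorAlgebraic`, from the top-degree proportionality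
  `stub_topPushProportional` and the transpose calculus `stub_corrTranspose`); compose `S′ ⊢ Σ ⊢ S`
  (`CompCorr` from `CupProductAlgebraic`).
* `twinSimilitudeAlgebraic_onHKSectorTargets` — **THE TARGET THEOREM: X for every pair whose TARGET
  `S` lies in the HK-Nikulin sector**, granted exactly the inputs of the sector theorem: the named
  Literature facts (K3 markings; the four hyperkähler facts), `CupProductAlgebraic` (stmt-HodgeConjecture-14350),
  Buskin `HodgeIsometryAlgebraic` (13675), `LefschetzOneOneK3` (13678), `AlgebraicClassesOneOneK3` (15041).
* `twinSimilitudeAlgebraic_onHKSector_either` — X whenever EITHER twin lies in the sector.  The sector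
  is NOT twin-symmetric (`T(S)_ℚ ≅ T(S′)_ℚ(2)` while `N(2)_ℚ ≅ U³ ⊕ E₈(−1) ⊕ ⟨−1⟩ ≇ N_ℚ`,
  discriminants `1` vs `2`), so this strictly enlarges the sector theorem: the Hasse-obstructed source
  types of rank `13, 14` whose twin type embeds in `N_ℚ` are NEW CASES (conditionally on the inputs).
* `twinSimilitudeAlgebraic_of_offHKSectorPairs` — X from the same inputs and the SHRUNKEN declared
  residual of the line: X for pairs with BOTH twins off the sector (rank `T ≥ 15`, i.e. `ρ ≤ 7`, and the
  doubly obstructed types of rank `13, 14`) — the open sub-case of the Hodge conjecture for `S × S′`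
  that no symplectic-automorphism anchor on a known hyperkähler deformation type reaches.

No definitions, no new named facts.

## References

* [Varesco2023] M. Varesco, Math. Z. 305 (2023), §2 (proof of Thm. 2.1), Thm. 2.1 and Prop. 2.5.
* [Buskin2019] N. Buskin, J. reine angew. Math. 755 (2019), Thm. 1.1 and Lemma 6.3.
* [CamereEtAl2026] C. Camere, A. Garbagnati, G. Kapustka, M. Kapustka, arXiv:2607.00130, Thm. 1.2, Thm. 5.12.
* [Markman2024] E. Markman, Compos. Math. 160 (2024), Thm. 1.1.
* [FultonYoungTableaux1997] W. Fulton, Young Tableaux, CUP 1997, Appendix B §B.1 (5)–(6).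
-/

noncomputable section

set_option linter.dupNamespace false

open CategoryTheory MonoidalCategory
open scoped Manifold Matrix
open Literature.AlgebraicGeometry.Motives Literature.AlgebraicGeometry.HodgeTheory
open Literature.AlgebraicGeometry.Surfaces Literature.AlgebraicGeometry.Hyperkaehler Literature.Geometry.Kaehler
open Literature.AlgebraicTopology.SingularHomology
open Summit.HodgeConjecture.HodgeConjecture.Theses.NikulinTwinTransport

namespace Summit.HodgeConjecture.HodgeConjecture.Theorems.NikulinTwinTransport

/-! ## Local notations (verbatim those of the skeleton / the route's Theorems files) -/

/-- `Gen[S, p]`: `p` is an integral generator of `H⁴(S(ℂ); ℂ)` (the generator clause of X). Local notation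
only. -/
local notation3 (prettyPrint := false) "Gen[" S ", " p "]" =>
  (IsIntegralClass p ∧ ∀ q : complexBetti S (2 * 2), IsIntegralClass q → ∃ n : ℤ, q = n • p)

/-- `Corr[μ, S, S', hS, hS' ; γ, y] = [γ]_* y = fst_*(snd^* y ∪ γ)`, the action of
`γ ∈ H⁴((S ⊗ S′)(ℂ); ℂ)` as a correspondence `H²(S′) → H²(S)` (the FIRST factor receives). Local notation
only, verbatim from the route's Theorems files; for `hS hS'` the K3 witnesses it is definitionally the
inline term of the route items. -/
local notation3 (prettyPrint := false) "Corr[" μ ", " S ", " S' ", " hS ", " hS' " ; " γ ", " y "]" =>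
  complexGysin μ
    (IsSmoothProjective.tensor_holds (IsK3Surface.isSmoothProjective hS)
      (IsK3Surface.isSmoothProjective hS'))
    (IsK3Surface.isSmoothProjective hS) (SemiCartesianMonoidalCategory.fst S S')
    (rfl : 2 * 1 + 2 * 2 + 2 * 2 = 2 * 1 + 2 * (2 + 2))
    (cupProduct (rfl : 2 * 1 + 2 * 2 = 2 * 1 + 2 * 2)
      (complexBetti.map (SemiCartesianMonoidalCategory.snd S S') (2 * 1) y) γ)

/-- `CompCorr`: composition of algebraic degree-`2` correspondences between smooth projective surfaces
acts as an algebraic correspondence — hypothesis (C) of `twinSimilitudeAlgebraic_of_anchor`, verbatim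
(the tree proves it from the multiplicativity `N² ∪ N² ⊆ N⁴`: `corrComp_surfaces_of_cup'`; route item
`TwinAnchorGlue` is its packaged use). Local notation only. -/
local notation3 (prettyPrint := false) "CompCorr" =>
  ∀ (μ : OrientationFamily), μ.HasPoincareDuality →
    ∀ (A B C : SchemeOver ℂ) (hA : IsSmoothProjective 2 A) (hB : IsSmoothProjective 2 B)
      (hC : IsSmoothProjective 2 C),
      ∀ γ ∈ algebraicClasses (MonoidalCategoryStruct.tensorObj A B) 2,
        ∀ γ₁ ∈ algebraicClasses (MonoidalCategoryStruct.tensorObj B C) 2,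
          ∃ γ₂ ∈ algebraicClasses (MonoidalCategoryStruct.tensorObj A C) 2,
            ∀ x : complexBetti C (2 * 1),
              complexGysin μ (IsSmoothProjective.tensor_holds hA hC) hA
                  (SemiCartesianMonoidalCategory.fst A C)
                  (rfl : 2 * 1 + 2 * 2 + 2 * 2 = 2 * 1 + 2 * (2 + 2))
                  (cupProduct (rfl : 2 * 1 + 2 * 2 = 2 * 1 + 2 * 2)
                    (complexBetti.map (SemiCartesianMonoidalCategory.snd A C) (2 * 1) x) γ₂) =
                complexGysin μ (IsSmoothProjective.tensor_holds hA hB) hA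
                  (SemiCartesianMonoidalCategory.fst A B)
                  (rfl : 2 * 1 + 2 * 2 + 2 * 2 = 2 * 1 + 2 * (2 + 2))
                  (cupProduct (rfl : 2 * 1 + 2 * 2 = 2 * 1 + 2 * 2)
                    (complexBetti.map (SemiCartesianMonoidalCategory.snd A B) (2 * 1)
                      (complexGysin μ (IsSmoothProjective.tensor_holds hB hC) hB
                        (SemiCartesianMonoidalCategory.fst B C)
                        (rfl : 2 * 1 + 2 * 2 + 2 * 2 = 2 * 1 + 2 * (2 + 2))
                        (cupProduct (rfl : 2 * 1 + 2 * 2 = 2 * 1 + 2 * 2)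
                          (complexBetti.map (SemiCartesianMonoidalCategory.snd B C) (2 * 1) x)
                          γ₁)))
                    γ)

/-- `OutAnchor[μ, S, Sg, hS, hSg, p, pg]`: AN ALGEBRAIC OUT-ANCHOR `2`-SIMILITUDE AT `S` WITH PARTNER
`Sg` — a `ℂ`-linear equivalence `Ψ : H²(S) ≃ H²(Sg)` which is algebraic (the action of an algebraic
class on `Sg ⊗ S`) and whose inverse is rational, type-preserving and HALVES the cup form
(`(u.v) = 2b·pg ⟹ (Ψ⁻¹u.Ψ⁻¹v) = b·p`).  Symbol for symbol the body of `AnchorData[μ, Sg, hSg, pg]`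
(= the body of the route crux `TwinTwistorTransport` at `Sg`) with the partner `S″ := S`, `p″ := p`.
Local notation only. -/
local notation3 (prettyPrint := false)
    "OutAnchor[" μ ", " S ", " Sg ", " hS ", " hSg ", " p ", " pg "]" =>
  ∃ Ψ : complexBetti S (2 * 1) ≃ₗ[ℂ] complexBetti Sg (2 * 1),
    (∀ y, IsRationalClass y → IsRationalClass (Ψ.symm y)) ∧
    (∀ (i j : ℕ) y, IsOfHodgeType 2 Sg (2 * 1) i j y →
      IsOfHodgeType 2 S (2 * 1) i j (Ψ.symm y)) ∧
    (∀ (u v : complexBetti Sg (2 * 1)) (b : ℂ),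
      cupProduct (rfl : 2 * 1 + 2 * 1 = 2 * 2) u v = ((2 : ℂ) * b) • pg →
        cupProduct (rfl : 2 * 1 + 2 * 1 = 2 * 2) (Ψ.symm u) (Ψ.symm v) = b • p) ∧
    ∃ γ ∈ algebraicClasses (MonoidalCategoryStruct.tensorObj Sg S) 2,
      ∀ x : complexBetti S (2 * 1), Ψ x = Corr[μ, Sg, S, hSg, hS ; γ, x]

/-- `XBody[μ, S, S', hS, hS', p, p']`: the body of X at one pair after the generator prefix — every rational,
type-preserving `2`-similitude `ψ : H²(S′) → H²(S)` is the action of an algebraic class on `S ⊗ S′`.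
Local notation only (verbatim the corresponding segment of the route decl). -/
local notation3 (prettyPrint := false) "XBody[" μ ", " S ", " S' ", " hS ", " hS' ", " p ", " p' "]" =>
  ∀ (ψ : complexBetti S' (2 * 1) →ₗ[ℂ] complexBetti S (2 * 1)),
    (∀ x, IsRationalClass x → IsRationalClass (ψ x)) →
    (∀ (i j : ℕ) x, IsOfHodgeType 2 S' (2 * 1) i j x → IsOfHodgeType 2 S (2 * 1) i j (ψ x)) →
    (∀ (x y : complexBetti S' (2 * 1)) (a : ℂ),
      cupProduct (rfl : 2 * 1 + 2 * 1 = 2 * 2) x y = a • p' →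
        cupProduct (rfl : 2 * 1 + 2 * 1 = 2 * 2) (ψ x) (ψ y) = ((2 : ℂ) * a) • p) →
    ∃ γ ∈ algebraicClasses (MonoidalCategoryStruct.tensorObj S S') 2,
      ∀ x : complexBetti S' (2 * 1), ψ x = Corr[μ, S, S', hS, hS' ; γ, x]

/-! ## X at pairs whose TARGET is in the sector -/

/-- **X at one pair from one out-anchor at the TARGET** (the transpose form of `simAlg_at_of_outAnchor`):
for a projective K3 `S` with an algebraic out-anchor `Ψ : H²(S) ⥲ H²(Σ)` (inverse rational, type-preserving,
halving) and ANY rational, type-preserving `2`-similitude `ψ : H²(S′) → H²(S)` from a projective K3 `S′`,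
`φ := ½ · (Ψ ∘ ψ) : H²(S′) → H²(Σ)` is rational, type-preserving (`stub_anchorForward`) and an ISOMETRY
(`(x.y) = a·p′ ⟹ (ψx.ψy) = 2a·p ⟹ (Ψψx.Ψψy) = 4a·pΣ ⟹ (φx.φy) = a·pΣ`), hence `[β]_*` with `β` algebraic on
`Σ ⊗ S′` by Buskin (`HodgeIsometryAlgebraic` at `(Σ, S′)`); `Ψ ∘ ψ = [2β]_*` (`induced_smul`), `Ψ⁻¹ = [γ′]_*`
is algebraic (`stub_inverseAnchorAlgebraic` with `stub_topPushProportional`, `stub_corrTranspose`), and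
`ψ = Ψ⁻¹ ∘ (Ψ ∘ ψ)` is the composition `S′ ⊢ Σ ⊢ S` (`CompCorr`). [cite: Varesco2023, §2 (proof of Thm. 2.1)]
[cite: Buskin2019, Thm. 1.1 and Lemma 6.3] -/
theorem simAlg_at_of_outAnchor_target (hmk : Huybrechts_K3_marking_exists)
    (hB : HodgeIsometryAlgebraic) (hC : CompCorr)
    {μ : OrientationFamily} (hμ : μ.HasPoincareDuality)
    {S : SchemeOver ℂ} (hS : IsK3Surface S) {p : complexBetti S (2 * 2)} (hp : Gen[S, p])
    {Sg : SchemeOver ℂ} (hSg : IsK3Surface Sg) {pg : complexBetti Sg (2 * 2)} (hpg : Gen[Sg, pg])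
    (hA : OutAnchor[μ, S, Sg, hS, hSg, p, pg])
    (S' : SchemeOver ℂ) (hS' : IsK3Surface S') (p' : complexBetti S' (2 * 2)) (hp' : Gen[S', p']) :
    XBody[μ, S, S', hS, hS', p, p'] := by
  intro ψ hψr hψt hψs
  obtain ⟨Ψ, hΨr, hΨt, hΨs, γ, hγ, hΨγ⟩ := hA
  obtain ⟨hΨr', hΨt', hΨs'⟩ := stub_anchorForward hmk S Sg hS hSg p pg hp hpg Ψ hΨr hΨt hΨs
  -- `φ := ½ · (Ψ ∘ ψ) : H²(S′) → H²(Σ)` is a rational Hodge isometry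
  set φ : complexBetti S' (2 * 1) →ₗ[ℂ] complexBetti Sg (2 * 1) :=
    (((1 / 2 : ℚ) : ℂ)) • (Ψ.toLinearMap ∘ₗ ψ) with hφdef
  have hφ : ∀ x, φ x = ((1 / 2 : ℚ) : ℂ) • Ψ (ψ x) := fun x => rfl
  have hφr : ∀ x, IsRationalClass x → IsRationalClass (φ x) := fun x hx => by
    rw [hφ]
    exact (hΨr' _ (hψr x hx)).smul (1 / 2 : ℚ)
  have hφt : ∀ (i j : ℕ) x, IsOfHodgeType 2 S' (2 * 1) i j x →
      IsOfHodgeType 2 Sg (2 * 1) i j (φ x) := fun i j x hx => by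
    rw [hφ]
    exact (hΨt' i j _ (hψt i j x hx)).smul _
  have hhalf : (((1 / 2 : ℚ) : ℂ)) = (2 : ℂ)⁻¹ := by push_cast; ring
  have hφs : ∀ (x y : complexBetti S' (2 * 1)) (a : ℂ),
      cupProduct (rfl : 2 * 1 + 2 * 1 = 2 * 2) x y = a • p' →
        cupProduct (rfl : 2 * 1 + 2 * 1 = 2 * 2) (φ x) (φ y) = a • pg := by
    intro x y a hxy
    have h4 := hΨs' (ψ x) (ψ y) ((2 : ℂ) * a) (hψs x y a hxy)
    rw [hφ, hφ]
    simp only [map_smul, LinearMap.smul_apply]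
    rw [h4, smul_smul, smul_smul, hhalf]
    congr 1
    ring
  -- Buskin at `(Σ, S′)`: `φ = [β]_*`; hence `Ψ ∘ ψ = 2 • φ = [2 • β]_*`
  obtain ⟨β, hβ, hφβ⟩ := hB μ hμ Sg S' hSg hS' pg p' hpg hp' φ hφr hφt hφs
  obtain ⟨β₂, hβ₂, h2φ⟩ := induced_smul
    (IsSmoothProjective.tensor_holds (IsK3Surface.isSmoothProjective hSg)
      (IsK3Surface.isSmoothProjective hS')) (IsK3Surface.isSmoothProjective hSg)
    (rfl : 2 * 1 + 2 * 2 = 2 * 1 + 2 * 2) (rfl : 2 * 1 + 2 * 2 + 2 * 2 = 2 * 1 + 2 * (2 + 2))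
    (2 : ℂ) ⟨β, hβ, hφβ⟩
  have hΨψ : ∀ x, Ψ (ψ x) = ((2 : ℂ) • φ) x := fun x => by
    rw [LinearMap.smul_apply, hφ, smul_smul, hhalf, mul_inv_cancel₀ (two_ne_zero' ℂ), one_smul]
  -- the inverse of the out-anchor is algebraic
  obtain ⟨γ', hγ', hΨ'⟩ := stub_inverseAnchorAlgebraic stub_topPushProportional stub_corrTranspose hmk μ
    hμ S Sg hS hSg p pg hp hpg Ψ hΨs ⟨γ, hγ, hΨγ⟩
  -- compose `S′ ⊢ Σ ⊢ S`
  obtain ⟨γ₂, hγ₂, hcomp⟩ := hC μ hμ S Sg S' (IsK3Surface.isSmoothProjective hS)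
    (IsK3Surface.isSmoothProjective hSg) (IsK3Surface.isSmoothProjective hS') γ' hγ' β₂ hβ₂
  refine ⟨γ₂, hγ₂, fun x => ?_⟩
  rw [hcomp x, ← h2φ x, ← hΨψ x, ← hΨ' (Ψ (ψ x)), LinearEquiv.symm_apply_apply]

/-- **THE TARGET THEOREM: X for every pair whose TARGET `S` lies in the HK-Nikulin sector** — the
out-anchor at the target (`outAnchor_onHKSector`: the heart of the line + the three completion stubs),
then `simAlg_at_of_outAnchor_target`.  Granted the named facts, `CupProductAlgebraic`, Buskin and the
two `(1,1)` items, exactly as the sector theorem. [cite: Varesco2023, §2 (proof of Thm. 2.1)]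
[cite: CamereEtAl2026, Thm. 1.2 and Thm. 5.12] [cite: Markman2024, Thm. 1.1] [cite: Buskin2019, Thm. 1.1] -/
theorem twinSimilitudeAlgebraic_onHKSectorTargets
    (h₀ : (Huybrechts_K3_marking_exists ∧ CamereEtAl2026_symplecticInvolution_periodSurjective ∧
        CamereEtAl2023_fixedK3_restriction ∧ Markman2024_rationalHodgeIsometry_algebraic_marked ∧
        Beauville1983_hilbertSquare_markedIncidence))
    (hC : Summit.HodgeConjecture.HodgeConjecture.Theses.EndoscopicMiddleDegree.CupProductAlgebraic)
    (hB : HodgeIsometryAlgebraic) (hL : LefschetzOneOneK3) (hN : AlgebraicClassesOneOneK3)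
    {μ : OrientationFamily} (hμ : μ.HasPoincareDuality)
    (S S' : SchemeOver ℂ) (hS : IsK3Surface S) (hS' : IsK3Surface S')
    (p : complexBetti S (2 * 2)) (p' : complexBetti S' (2 * 2)) (hp : Gen[S, p]) (hp' : Gen[S', p'])
    (hsec : InHKNikulinSector S) :
    XBody[μ, S, S', hS, hS', p, p'] := by
  obtain ⟨Sg, hSg, pg, hpg, hA⟩ := outAnchor_onHKSector h₀ hC hL hN hμ hS hp hsec
  exact simAlg_at_of_outAnchor_target h₀.1 hB (compCorr_of_cupProductAlgebraic' hC) hμ hS hp hSg hpg hA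
    S' hS' p' hp'

/-- **X whenever EITHER twin lies in the HK-Nikulin sector** (sector theorem at the source, target theorem
at the target).  The sector is not twin-symmetric (`N(2)_ℚ ≇ N_ℚ`), so this strictly enlarges the sector
theorem. [cite: Varesco2023, Thm. 2.1 and Prop. 2.5] [cite: CamereEtAl2026, Thm. 1.2] -/
theorem twinSimilitudeAlgebraic_onHKSector_either
    (h₀ : (Huybrechts_K3_marking_exists ∧ CamereEtAl2026_symplecticInvolution_periodSurjective ∧
        CamereEtAl2023_fixedK3_restriction ∧ Markman2024_rationalHodgeIsometry_algebraic_marked ∧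
        Beauville1983_hilbertSquare_markedIncidence))
    (hC : Summit.HodgeConjecture.HodgeConjecture.Theses.EndoscopicMiddleDegree.CupProductAlgebraic)
    (hB : HodgeIsometryAlgebraic) (hL : LefschetzOneOneK3) (hN : AlgebraicClassesOneOneK3)
    {μ : OrientationFamily} (hμ : μ.HasPoincareDuality)
    (S S' : SchemeOver ℂ) (hS : IsK3Surface S) (hS' : IsK3Surface S')
    (p : complexBetti S (2 * 2)) (p' : complexBetti S' (2 * 2)) (hp : Gen[S, p]) (hp' : Gen[S', p'])
    (hsec : InHKNikulinSector S' ∨ InHKNikulinSector S) :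
    XBody[μ, S, S', hS, hS', p, p'] := by
  rcases hsec with hsec | hsec
  · exact twinSimilitudeAlgebraic_onHKSector h₀ hC hB hL hN hμ S S' hS hS' p p' hp hp' hsec
  · exact twinSimilitudeAlgebraic_onHKSectorTargets h₀ hC hB hL hN hμ S S' hS hS' p p' hp hp' hsec

/-- **X from the same inputs and the SHRUNKEN declared residual** (X verbatim for pairs with BOTH twins off
the sector — what this line leaves of the crux after reshape r6; implied by the transport crux
`TwinTwistorTransport`, stmt-HodgeConjecture-14393, through Buskin and `TwinAnchorGlue`, and by
`HodgeSimilitudeAlgebraic`, 13676): by cases on the sector at the source and at the target.  A CONDITIONAL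
proof of the route's crux `TwinSimilitudeAlgebraic`. [cite: Varesco2023, Thm. 2.1 and Prop. 2.5]
[cite: CamereEtAl2026, Thm. 1.2] -/
theorem twinSimilitudeAlgebraic_of_offHKSectorPairs
    (h₀ : (Huybrechts_K3_marking_exists ∧ CamereEtAl2026_symplecticInvolution_periodSurjective ∧
        CamereEtAl2023_fixedK3_restriction ∧ Markman2024_rationalHodgeIsometry_algebraic_marked ∧
        Beauville1983_hilbertSquare_markedIncidence))
    (hC : Summit.HodgeConjecture.HodgeConjecture.Theses.EndoscopicMiddleDegree.CupProductAlgebraic)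
    (hB : HodgeIsometryAlgebraic) (hL : LefschetzOneOneK3) (hN : AlgebraicClassesOneOneK3)
    (hoff : ∀ (μ : OrientationFamily), μ.HasPoincareDuality →
      ∀ (S S' : SchemeOver ℂ) (hS : IsK3Surface S) (hS' : IsK3Surface S')
        (p : complexBetti S (2 * 2)) (p' : complexBetti S' (2 * 2)), Gen[S, p] → Gen[S', p'] →
        ∀ (ψ : complexBetti S' (2 * 1) →ₗ[ℂ] complexBetti S (2 * 1)),
          (∀ x, IsRationalClass x → IsRationalClass (ψ x)) →
          (∀ (i j : ℕ) x, IsOfHodgeType 2 S' (2 * 1) i j x → IsOfHodgeType 2 S (2 * 1) i j (ψ x)) →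
          (∀ (x y : complexBetti S' (2 * 1)) (a : ℂ),
            cupProduct (rfl : 2 * 1 + 2 * 1 = 2 * 2) x y = a • p' →
              cupProduct (rfl : 2 * 1 + 2 * 1 = 2 * 2) (ψ x) (ψ y) = ((2 : ℂ) * a) • p) →
          ¬ InHKNikulinSector S' → ¬ InHKNikulinSector S →
          ∃ γ ∈ algebraicClasses (MonoidalCategoryStruct.tensorObj S S') 2,
            ∀ x : complexBetti S' (2 * 1), ψ x = Corr[μ, S, S', hS, hS' ; γ, x]) :
    Summit.HodgeConjecture.HodgeConjecture.Theses.NikulinTwinTransport.TwinSimilitudeAlgebraic := by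
  intro μ hμ S S' hS hS' p p' hp hp' ψ hψr hψt hψs
  by_cases hsec' : InHKNikulinSector S'
  · exact twinSimilitudeAlgebraic_onHKSector h₀ hC hB hL hN hμ S S' hS hS' p p' hp hp' hsec' ψ hψr hψt hψs
  · by_cases hsec : InHKNikulinSector S
    · exact twinSimilitudeAlgebraic_onHKSectorTargets h₀ hC hB hL hN hμ S S' hS hS' p p' hp hp' hsec ψ
        hψr hψt hψs
    · exact hoff μ hμ S S' hS hS' p p' hp hp' ψ hψr hψt hψs hsec' hsec

/-- Registered anchor of this file: closed form of `twinSimilitudeAlgebraic_of_offHKSectorPairs` — X from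
the named facts, `CupProductAlgebraic`, Buskin, the two `(1,1)` items and the shrunken declared residual
(pairs with both twins off the sector). [cite: Varesco2023, Thm. 2.1 and Prop. 2.5] [cite: CamereEtAl2026, Thm. 1.2] -/
theorem hkTargetTheorem_anchor :
    (Huybrechts_K3_marking_exists ∧ CamereEtAl2026_symplecticInvolution_periodSurjective ∧
        CamereEtAl2023_fixedK3_restriction ∧ Markman2024_rationalHodgeIsometry_algebraic_marked ∧
        Beauville1983_hilbertSquare_markedIncidence) →
    Summit.HodgeConjecture.HodgeConjecture.Theses.EndoscopicMiddleDegree.CupProductAlgebraic →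
    HodgeIsometryAlgebraic → LefschetzOneOneK3 → AlgebraicClassesOneOneK3 →
    (∀ (μ : OrientationFamily), μ.HasPoincareDuality →
      ∀ (S S' : SchemeOver ℂ) (hS : IsK3Surface S) (hS' : IsK3Surface S')
        (p : complexBetti S (2 * 2)) (p' : complexBetti S' (2 * 2)), Gen[S, p] → Gen[S', p'] →
        ∀ (ψ : complexBetti S' (2 * 1) →ₗ[ℂ] complexBetti S (2 * 1)),
          (∀ x, IsRationalClass x → IsRationalClass (ψ x)) →
          (∀ (i j : ℕ) x, IsOfHodgeType 2 S' (2 * 1) i j x → IsOfHodgeType 2 S (2 * 1) i j (ψ x)) →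
          (∀ (x y : complexBetti S' (2 * 1)) (a : ℂ),
            cupProduct (rfl : 2 * 1 + 2 * 1 = 2 * 2) x y = a • p' →
              cupProduct (rfl : 2 * 1 + 2 * 1 = 2 * 2) (ψ x) (ψ y) = ((2 : ℂ) * a) • p) →
          ¬ InHKNikulinSector S' → ¬ InHKNikulinSector S →
          ∃ γ ∈ algebraicClasses (MonoidalCategoryStruct.tensorObj S S') 2,
            ∀ x : complexBetti S' (2 * 1), ψ x = Corr[μ, S, S', hS, hS' ; γ, x]) →
    Summit.HodgeConjecture.HodgeConjecture.Theses.NikulinTwinTransport.TwinSimilitudeAlgebraic :=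
  fun h₀ hC hB hL hN hoff => twinSimilitudeAlgebraic_of_offHKSectorPairs h₀ hC hB hL hN hoff

end Summit.HodgeConjecture.HodgeConjecture.Theorems.NikulinTwinTransport

end
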